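/-
Copyright (c) 2026 the pub-hodgecm-mathlib formalisation cell (harness21).  Prover seat hodgecm-mathlib-F0P2-p02 (g11): road «S3-tree» (LEAD F0P3a-plan (g11), architect
A-p16 (g29) ruling A-85 (4) «bad-reduction frame transport for SPAN-0 ∕ the partial head»), 2026-09-01.
-/
import Literature.NumberTheory.Rogawski1990.FinExplicitTransferFactorColumnUnit     -- ★ `isUnit_finColumnFormValue_of_col_ne_zero`; brings ★ `…GHRegular`, ★ `…KappaEigenvector`, ★ `…ConjRight`, ★ `…ConjLeft`, ★ `…Nondegenerate`
import Literature.NumberTheory.Rogawski1990.LocalStableClassesNonsplitKappa        -- ★ `sum_sum_map_mulVec_mul_mul_mulVec_eq_twistGram`, `sum_sum_map_col_mul_mul_col_eq_twistGram_apply`; brings ★ `QuadraticLocalNormGroupNonsplit`, ★ `LocalStableClassesNonsplit`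
import Literature.NumberTheory.Rogawski1990.DeltaTransferTransport                 -- ★ `isLocalNormPair_iff_comp_of_corresponds`, `isLocSmooth_comp_homeomorph`; brings ★ `LocalTransferTransport` (`OrbitalMeasureFamily.transport`, `preClass`)
import Literature.NumberTheory.Automorphic.LocalUnitaryGroupSimilitude              -- ★ `corresponds_cmDatumLocalCongr_symm`; brings ★ `cmDatumLocalCongr`, `coe_cmDatumLocalCongr_apply`
import HarnessLib

/-!
# Rogawski's explicit transfer factor under a change of hermitian form at a non-split place: `Δ‴_v^{Φ₃}(γ_H, T⁻¹γ′T) = χ(a)·Δ‴_v^{H′}(γ_H, γ′)` for a local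
# similitude `ᵗ(σT)·H′_v·T = a·Φ₃`, and the transport of `Δ‴`-transfer identities at the identity along it
# (Rogawski 1990, §4.3 (4.3.2) p. 43, §3.5 Prop. 3.5.2 (c) p. 29, §14.2 p. 232, §14.4 p. 237; Langlands–Shelstad 1987 §1, §4.2)

Topic `NumberTheory/Rogawski1990`; namespace `Literature.NumberTheory.Rogawski1990`.  THEOREMS ONLY (no definition, no named fact, no instance, no notation,
no `sorry`); kernel lane.  Cell `pub/hodgecm-mathlib` (D-0151), crux H413 = `stmt-HodgeConjecture-24833`; road «S3-tree» (LEAD F0P3a-plan (g11), architect A-p16 (g29)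
ruling A-85 (4): «bad-reduction frame transport for SPAN-0 ∕ the partial head — so that the good-reduction pair `hH′w hH′i` drops»).  Seat F0P2-p02 (g11); census
2026-09-01T18:19Z (F0∕P3a bus).

THE MATHEMATICS.  `L` a CM field, `v` a finite place of `L⁺` that does NOT split in `L` (one place `w ∣ v`, `E_v := L ⊗ L⁺_v = L_w` a field), `σ = c ⊗ 1`, `H′ ∈ M₃(L)`
`c`-hermitian with `det H′ ≠ 0`.  By the rank-3 local classification (★ `exists_formCongr_map_eq_smul_antidiag_of_smul_eq`, [Jacobowitz1962, Thm. 3.1]) there are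
`T ∈ GL₃(E_v)` and a `σ`-fixed unit `a` with `ᵗ(σT)·H′_v·T = a·Φ₃` — at EVERY non-split `v`, with no «good reduction» of `H′` at `w` asked (the pair `hH′w hH′i` of ★
`span_isSelfDual_std` ∕ T3′); along it `e := cmDatumLocalCongr … : U(Φ₃)(L⁺_v) ≃ₜ* U(H′)(L⁺_v)`, `(e g) = T g T⁻¹` (★ `LocalUnitaryGroupCongr`).  Rogawski's EXPLICIT factor
`Δ‴_v(γ_H, γ′) = [ι(γ_H) ↔ γ′]·τ_v(γ_H)·D_v(γ_H)·κ_v(γ_H, γ′)` (★ `finExplicitDelta`) depends on the hermitian form only through `κ_v`, the unit-norm class of the length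
`⟨p′, p′⟩_{H′}` of a `u`-eigenvector `p′` of `γ′` (★ `finKappaAt_eq_ite_of_eigenvector`).  For `γ′ ∈ U(H′)_v` the element `e⁻¹γ′ = T⁻¹γ′T ∈ U(Φ₃)_v` has the
`u`-eigenvector `T⁻¹p′`, and `⟨T⁻¹p′, T⁻¹p′⟩_{Φ₃} = a⁻¹·⟨p′, p′⟩_{H′}` (§1); since the norm group has index two in the `σ`-fixed units (★ `exists_norm_mul_iff_norm_tests_iff`)
and `⟨p′, p′⟩_{H′} ≠ 0` on `G`-regular matching pairs (★ `isUnit_finColumnFormValue_of_col_ne_zero`),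
  **`κ_v^{Φ₃}(γ_H, e⁻¹γ′) = χ(a)·κ_v^{H′}(γ_H, γ′)`**, `χ(a) := +1` if `a = z·σz` for a unit `z`, `−1` otherwise (§2) —
the Kottwitz–Langlands–Shelstad sign of the pure inner form `H′_w` relative to `Φ₃` (for `v` unramified: `χ(a) = (−1)^{v(a)}`, forced to `−1` exactly when `v_w(det H′)` is odd),
[LanglandsShelstad1987, §4.2]; [Rogawski1990, §4.3 (4.3.2)].  Hence **`Δ‴_v^{Φ₃}(γ_H, e⁻¹γ′) = χ(a)·Δ‴_v^{H′}(γ_H, γ′)`** for `G`-regular `γ_H` (§3; matching pairs correspond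
along the class-preserving `e`, ★ `isLocalNormPair_iff_comp_of_corresponds`), the `Δ‴`-weighted orbital sums transport with the factor `χ(a)` (§4: reindex the classes along `e`,
★ `classOrbitalIntegral_transport`, `conj_right` = ★ `finExplicitDelta_conj_right_all`), and a `Δ‴`-TRANSFER IDENTITY AT THE IDENTITY («`∃ V ∈ 𝓝 1, ∃ φ^H ∈ C_c^∞(H_v), ∀ γ_H ∈ V`
`G`-regular, `Φ^st(γ_H, φ^H) = Σᶠ_c Δ‴_v(γ_H, c)·Φ(c, ·)`», the conclusion of the S3-tree partial head `localTransferAtOne_of_hyperspecialLevel_le_two` and of `stub_N6nsS3id`)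
for the transported pair `(e⁻¹_* m_G, g ∘ e)` on `U(Φ₃)_v` yields the same identity VERBATIM for `(m_G, g)` on `U(H′)_v`, with `φ^H ↦ χ(a)·φ^H` (§5).  USE: the S3-tree END proves
its partial head for `Φ₃` (good reduction at every `w` for free); for ANY `H′` — bad reduction at `w` included, where `K_std(H′) = U(H′)(𝒪_v)` is not hyperspecial and, for
`v_w(det H′)` odd, `H′_w` has no self-dual lattice at all — the pieces live on the hyperspecial `e(K₃)` and §5 carries the identity over: the pair `hH′w hH′i` drops.
HONEST LABEL: HC_CM is proved only modulo the 2 remaining named inputs (hLiu418 24832, h413 24833) until rung 0 closes; nothing printed is asserted here (local linear algebra +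
reindexing); S3 (`stub_N6nsS3id`) stays a print row until the road's END lands.

* §1 `sum_sum_map_inv_mulVec_eq_inv_mul` — `⟨T⁻¹p, T⁻¹p⟩_{Φ₃} = a⁻¹·⟨p, p⟩_{H′}`.
* §2 **`finKappaAt_cmDatumLocalCongr_symm`** — `κ_v^{Φ₃}(γ_H, e⁻¹γ′) = χ(a)·κ_v^{H′}(γ_H, γ′)` on `G`-regular matching pairs.
* §3 **`finExplicitDelta_cmDatumLocalCongr_symm`** — `Δ‴_v^{Φ₃}(γ_H, e⁻¹γ′) = χ(a)·Δ‴_v^{H′}(γ_H, γ′)` (`γ_H` `G`-regular, all `γ′`).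
* §4 **`finsum_finExplicitDelta_mul_classOrbitalIntegral_transport`** — the `Δ‴`-weighted orbital sums along `e`.
* §5 **`localTransferAtOne_transport_of_formCongr`** — the `Δ‴`-transfer identity at `1` descends from `(Φ₃, e⁻¹_* m_G, g ∘ e)` to `(H′, m_G, g)`.

## References
* [Rogawski1990] J. D. Rogawski, *Automorphic Representations of Unitary Groups in Three Variables*, Ann. of Math. Stud. 123 (1990), §3.5 Prop. 3.5.2 (c) p. 29; §4.3
  (4.3.2) p. 43; §4.9 p. 55; §14.2 p. 232; §14.4 p. 237; §14.6 p. 242.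
* [LanglandsShelstad1987] R. P. Langlands, D. Shelstad, *On the definition of transfer factors*, Math. Ann. 278 (1987), §1 (`inv(γ_H, γ_G)`), §4.2 (change of the inner twist).
* [Jacobowitz1962] R. Jacobowitz, *Hermitian forms over local fields*, Amer. J. Math. 84 (1962), §3 Thm. 3.1.
* [Kottwitz1986] R. E. Kottwitz, *Stable trace formula: elliptic singular terms*, Math. Ann. 275 (1986), §7.
-/

set_option autoImplicit false

noncomputable section

open NumberField IsDedekindDomain Matrix Topology Filter
open Literature.NumberTheory.GaloisRepresentations
open scoped MatrixGroups

namespace Literature.NumberTheory.Rogawski1990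

open Literature.NumberTheory.Automorphic Literature.NumberTheory.Automorphic.UnitaryGroup
open Literature.AlgebraicGeometry.ShimuraVarieties (unitaryGroup)

variable (L : Type) [Field L] [NumberField L] [IsCMField L] (v : HeightOneSpectrum (𝓞 ↥(maximalRealSubfield L)))
  (H' : Matrix (Fin 3) (Fin 3) L)
  (T : GL (Fin 3) (UnitaryGroup.LocalRing L v)) {a : UnitaryGroup.LocalRing L v} (ha : IsUnit a)
  (h : formCongr (UnitaryGroup.conjLocal L (IsCMField.complexConj L) v) T (H'.map (algebraMap L (UnitaryGroup.LocalRing L v))) =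
    a • (Matrix.of fun i j : Fin 3 => if i.val + j.val + 1 = 3 then (1 : L) else 0).map (algebraMap L (UnitaryGroup.LocalRing L v)))

/-! ## §1 The eigenvector length against the two forms -/

include h in
/-- **`⟨T⁻¹p, T⁻¹p⟩_{Φ₃} = a⁻¹·⟨p, p⟩_{H′}`** for a local similitude `ᵗ(σT)·H′_v·T = a·Φ₃,v` (`a` a unit): the value of `T⁻¹p` against `Φ₃,v` is the value of `p`
against `ᵗ(σT⁻¹)·Φ₃,v·T⁻¹ = a⁻¹·H′_v` (★ `sum_sum_map_mulVec_mul_mul_mulVec_eq_twistGram`, ★ `twistGram_mul`).  The local forms are written `(adelicForm L 3 ·).map (adeleToLocal L v)`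
(= `·.map (algebraMap L E_v)`, ★ `adelicForm_map_adeleToLocal`), the currency of ★ `finKappaAt`. [cite: Rogawski1990, §3.1 p. 19; §3.5 Prop. 3.5.2 (c) p. 29] -/
theorem sum_sum_map_inv_mulVec_eq_inv_mul (p : Fin 3 → UnitaryGroup.LocalRing L v) :
    (∑ i : Fin 3, ∑ k : Fin 3, UnitaryGroup.conjLocal L (IsCMField.complexConj L) v (((T⁻¹ : GL (Fin 3) (UnitaryGroup.LocalRing L v)).val *ᵥ p) i) *
        ((UnitaryGroup.adelicForm L 3 (Matrix.of fun i j : Fin 3 => if i.val + j.val + 1 = 3 then (1 : L) else 0)).map (UnitaryGroup.adeleToLocal L v)) i k *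
          ((T⁻¹ : GL (Fin 3) (UnitaryGroup.LocalRing L v)).val *ᵥ p) k) =
      (↑(ha.unit⁻¹) : UnitaryGroup.LocalRing L v) *
        ∑ i : Fin 3, ∑ k : Fin 3, UnitaryGroup.conjLocal L (IsCMField.complexConj L) v (p i) *
          ((UnitaryGroup.adelicForm L 3 H').map (UnitaryGroup.adeleToLocal L v)) i k * p k := by
  rw [sum_sum_map_mulVec_mul_mul_mulVec_eq_twistGram, adelicForm_map_adeleToLocal, adelicForm_map_adeleToLocal]
  -- `ᵗ(σT)·H′_v·T = a·Φ₃,v` read as `ᵗ(σT⁻¹)·Φ₃,v·T⁻¹ = a⁻¹·H′_v`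
  have hT : twistGram (UnitaryGroup.conjLocal L (IsCMField.complexConj L) v) (H'.map (algebraMap L (UnitaryGroup.LocalRing L v))) T.val =
        a • (Matrix.of fun i j : Fin 3 => if i.val + j.val + 1 = 3 then (1 : L) else 0).map (algebraMap L (UnitaryGroup.LocalRing L v)) := h
  have h1 : H'.map (algebraMap L (UnitaryGroup.LocalRing L v)) =
      a • twistGram (UnitaryGroup.conjLocal L (IsCMField.complexConj L) v)
        ((Matrix.of fun i j : Fin 3 => if i.val + j.val + 1 = 3 then (1 : L) else 0).map (algebraMap L (UnitaryGroup.LocalRing L v)))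
        (T⁻¹ : GL (Fin 3) (UnitaryGroup.LocalRing L v)).val := by
    calc H'.map (algebraMap L (UnitaryGroup.LocalRing L v))
        = twistGram (UnitaryGroup.conjLocal L (IsCMField.complexConj L) v) (H'.map (algebraMap L (UnitaryGroup.LocalRing L v)))
            (T.val * (T⁻¹ : GL (Fin 3) (UnitaryGroup.LocalRing L v)).val) := by
          rw [Units.mul_inv, twistGram_def, Matrix.map_one _ (map_zero _) (map_one _), transpose_one, Matrix.one_mul, Matrix.mul_one]
      _ = a • twistGram (UnitaryGroup.conjLocal L (IsCMField.complexConj L) v)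
            ((Matrix.of fun i j : Fin 3 => if i.val + j.val + 1 = 3 then (1 : L) else 0).map (algebraMap L (UnitaryGroup.LocalRing L v)))
            (T⁻¹ : GL (Fin 3) (UnitaryGroup.LocalRing L v)).val := by
          rw [twistGram_mul, hT, Matrix.mul_smul, Matrix.smul_mul, ← twistGram_def]
  have key : twistGram (UnitaryGroup.conjLocal L (IsCMField.complexConj L) v)
      ((Matrix.of fun i j : Fin 3 => if i.val + j.val + 1 = 3 then (1 : L) else 0).map (algebraMap L (UnitaryGroup.LocalRing L v)))
      (T⁻¹ : GL (Fin 3) (UnitaryGroup.LocalRing L v)).val =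
        (↑(ha.unit⁻¹) : UnitaryGroup.LocalRing L v) • H'.map (algebraMap L (UnitaryGroup.LocalRing L v)) := by
    conv_rhs => rw [h1]
    rw [smul_smul, ha.val_inv_mul, one_smul]
  rw [key]
  simp only [Matrix.smul_apply, smul_eq_mul, Finset.mul_sum]
  refine Finset.sum_congr rfl fun i _ => Finset.sum_congr rfl fun k _ => ?_
  ring

/-! ## §2 `κ_v` across the two forms: the sign `χ(a)` -/

open scoped Classical in
/-- **`κ_v^{Φ₃}(γ_H, e⁻¹γ′) = χ(a)·κ_v^{H′}(γ_H, γ′)` ON `G`-REGULAR MATCHING PAIRS** (`v` non-split, `e = cmDatumLocalCongr … : U(Φ₃)_v ≃ₜ* U(H′)_v` the conjugation by a local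
similitude `ᵗ(σT)·H′_v·T = a·Φ₃,v`, `χ_g(u)` a unit): the `u`-eigenvector `p′` of `γ′` (a non-zero column of `P_v`, ★ `localMatrix_mulVec_finEigenlineProjector_col`) gives the
`u`-eigenvector `T⁻¹p′` of `T⁻¹γ′T`, of `Φ₃`-length `a⁻¹·⟨p′, p′⟩_{H′}` (§1) with `⟨p′, p′⟩_{H′}` a `σ`-fixed unit (★ `isUnit_finColumnFormValue_of_col_ne_zero`); both signs read on
eigenvectors (★ `finKappaAt_eq_ite_of_eigenvector`) and the norm group has index two in the `σ`-fixed units (★ `exists_norm_mul_iff_norm_tests_iff`), whence the factor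
`χ(a) = ±1` according as `a` is a unit norm — `κ(inv)` changes by the character of the class of `a`, the invariant of the inner twist `H′_w` against `Φ₃`.
[cite: Rogawski1990, §4.3 (4.3.2) p. 43; §3.5 Prop. 3.5.2 (c) p. 29; §14.2 p. 232] [cite: LanglandsShelstad1987, §4.2] -/
theorem finKappaAt_cmDatumLocalCongr_symm (w : UnitaryGroup.PlacesOver L v) (hw : IsCMField.complexConj L • w.1 = w.1)
    (hH' : (H'.map (cmConjRingHom L))ᵀ = H') (hdet : H'.det ≠ 0) (haσ : UnitaryGroup.conjLocal L (IsCMField.complexConj L) v a = a)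
    (γH : (UnitaryGroup.cmDatum L 2 (Matrix.of fun i j : Fin 2 => if i.val + j.val + 1 = 2 then (1 : L) else 0)).Local v ×
      (UnitaryGroup.cmDatum L 1 (Matrix.of fun i j : Fin 1 => if i.val + j.val + 1 = 1 then (1 : L) else 0)).Local v)
    (hu : IsUnit ((finCharpolyTwo L v γH).eval (finGammaTwo L v γH))) (b : (UnitaryGroup.cmDatum L 3 H').Local v) (hb : IsLocalNormPair L H' v γH b) :
    finKappaAt L v (Matrix.of fun i j : Fin 3 => if i.val + j.val + 1 = 3 then (1 : L) else 0) γH ((UnitaryGroup.cmDatumLocalCongr L v T ha h).symm b) =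
      (if ∃ z : UnitaryGroup.LocalRing L v, IsUnit z ∧ a = z * UnitaryGroup.conjLocal L (IsCMField.complexConj L) v z then (1 : ℤ) else -1) *
        finKappaAt L v H' γH b := by
  classical
  -- the place data: `E_v` has one factor, `σ` is an involution, a `c`-anti-fixed `δ ≠ 0`
  have hv : Subsingleton (UnitaryGroup.PlacesOver L v) :=
    UnitaryGroup.PlacesOver.subsingleton_of_smul_eq (IsCMField.complexConj L) (IsCMField.complexConj_ne_one L) w hw
  obtain ⟨δ, hcδ, hδ⟩ : ∃ δ : L, IsCMField.complexConj L δ = -δ ∧ δ ≠ 0 := by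
    obtain ⟨ζ, hζ⟩ := not_forall.1 fun h0 => IsCMField.complexConj_ne_one L (AlgEquiv.ext h0)
    refine ⟨ζ - IsCMField.complexConj L ζ, by rw [map_sub, IsCMField.complexConj_apply_apply, neg_sub], fun h0 => hζ ?_⟩
    rw [sub_eq_zero] at h0
    exact h0.symm
  haveI : Algebra.IsQuadraticExtension ↥(maximalRealSubfield L) L := IsCMField.isQuadraticExtension L
  have hσσ : ∀ s, UnitaryGroup.conjLocal L (IsCMField.complexConj L) v (UnitaryGroup.conjLocal L (IsCMField.complexConj L) v s) = s :=
    Liu2021.LemD1OfPlace.conjLocal_conjLocal_apply L v (IsCMField.complexConj L) hcδ hδ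
  have hHh := UnitaryGroup.map_conjLocal_transpose_localForm L 3 H' v hH'
  -- the matching pair on the `Φ₃` side (`e` is class-preserving)
  have hcl : ∀ γ' : (UnitaryGroup.cmDatum L 3 H').Local v,
      Corresponds (UnitaryGroup.conjLocal L (IsCMField.complexConj L) v) ((UnitaryGroup.adelicForm L 3 H').map (UnitaryGroup.adeleToLocal L v))
        ((UnitaryGroup.adelicForm L 3 (Matrix.of fun i j : Fin 3 => if i.val + j.val + 1 = 3 then (1 : L) else 0)).map (UnitaryGroup.adeleToLocal L v))
        γ' ((UnitaryGroup.cmDatumLocalCongr L v T ha h).symm γ') :=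
    fun γ' => corresponds_comm.1 (corresponds_cmDatumLocalCongr_symm L v T ha h γ')
  have hb₀ : IsLocalNormPair L (Matrix.of fun i j : Fin 3 => if i.val + j.val + 1 = 3 then (1 : L) else 0) v γH
      ((UnitaryGroup.cmDatumLocalCongr L v T ha h).symm b) :=
    (isLocalNormPair_iff_comp_of_corresponds L H' v (UnitaryGroup.cmDatumLocalCongr L v T ha h).symm hcl γH b).1 hb
  -- a non-zero column `p′` of `P_v`: a `u`-eigenvector of `γ′` whose `H′`-length is a `σ`-fixed unit
  have hP := finEigenlineProjector_ne_zero_of_isUnit L v H' γH b hb hu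
  obtain ⟨j, hj⟩ : ∃ j : Fin 3, (fun i => finEigenlineProjector L v H' γH b i j) ≠ 0 := by
    by_contra hcon
    refine hP (Matrix.ext fun i j => ?_)
    by_contra hij
    exact hcon ⟨j, fun h0 => hij (congrFun h0 i)⟩
  have hp' := localMatrix_mulVec_finEigenlineProjector_col L v H' γH b hb j
  -- the `H′`-length of `p′` is the diagonal entry of the Gram matrix in the frame `P_v`: a `σ`-fixed unit
  have hxdef : (∑ i : Fin 3, ∑ k : Fin 3, UnitaryGroup.conjLocal L (IsCMField.complexConj L) v ((fun i => finEigenlineProjector L v H' γH b i j) i) *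
      ((UnitaryGroup.adelicForm L 3 H').map (UnitaryGroup.adeleToLocal L v)) i k * (fun i => finEigenlineProjector L v H' γH b i j) k) =
      twistGram (UnitaryGroup.conjLocal L (IsCMField.complexConj L) v) ((UnitaryGroup.adelicForm L 3 H').map (UnitaryGroup.adeleToLocal L v))
        (finEigenlineProjector L v H' γH b) j j :=
    sum_sum_map_col_mul_mul_col_eq_twistGram_apply (UnitaryGroup.conjLocal L (IsCMField.complexConj L) v)
      ((UnitaryGroup.adelicForm L 3 H').map (UnitaryGroup.adeleToLocal L v)) (finEigenlineProjector L v H' γH b) j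
  have hxu : IsUnit (twistGram (UnitaryGroup.conjLocal L (IsCMField.complexConj L) v) ((UnitaryGroup.adelicForm L 3 H').map (UnitaryGroup.adeleToLocal L v))
      (finEigenlineProjector L v H' γH b) j j) := by
    rw [← hxdef]
    exact isUnit_finColumnFormValue_of_col_ne_zero L v H' γH b hv hdet hb hu hj
  have hxσ : UnitaryGroup.conjLocal L (IsCMField.complexConj L) v
      (twistGram (UnitaryGroup.conjLocal L (IsCMField.complexConj L) v) ((UnitaryGroup.adelicForm L 3 H').map (UnitaryGroup.adeleToLocal L v))
        (finEigenlineProjector L v H' γH b) j j) =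
      twistGram (UnitaryGroup.conjLocal L (IsCMField.complexConj L) v) ((UnitaryGroup.adelicForm L 3 H').map (UnitaryGroup.adeleToLocal L v))
        (finEigenlineProjector L v H' γH b) j j := by
    -- ★ `map_twistGram_apply_self` is stated over a field: `E_v` is one at the non-split `v` (★ `isField_localRing_of_nonsplit`)
    letI : Field (UnitaryGroup.LocalRing L v) :=
      (Liu2021.LemD1IndexedNonVacuityNonsplitPlace.isField_localRing_of_nonsplit L v (IsCMField.complexConj L) hcδ hδ w hw).toField
    exact map_twistGram_apply_self (UnitaryGroup.conjLocal L (IsCMField.complexConj L) v) _ hσσ hHh _ j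
  -- the transported eigenvector `T⁻¹ p′` of `T⁻¹ γ′ T`
  have hTT : (T : GL (Fin 3) (UnitaryGroup.LocalRing L v)).val *ᵥ (((T⁻¹ : GL (Fin 3) (UnitaryGroup.LocalRing L v)).val *ᵥ fun i => finEigenlineProjector L v H' γH b i j)) =
      fun i => finEigenlineProjector L v H' γH b i j := by
    rw [mulVec_mulVec, ← Units.val_mul, mul_inv_cancel, Units.val_one, one_mulVec]
  have hp₀ : (((UnitaryGroup.cmDatumLocalCongr L v T ha h).symm b).val.val : Matrix (Fin 3) (Fin 3) (UnitaryGroup.LocalRing L v)) *ᵥ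
      (((T⁻¹ : GL (Fin 3) (UnitaryGroup.LocalRing L v)).val *ᵥ fun i => finEigenlineProjector L v H' γH b i j)) =
        finGammaTwo L v γH • (((T⁻¹ : GL (Fin 3) (UnitaryGroup.LocalRing L v)).val *ᵥ fun i => finEigenlineProjector L v H' γH b i j)) := by
    have h1 : b.val = T * ((UnitaryGroup.cmDatumLocalCongr L v T ha h).symm b).val * T⁻¹ := by
      rw [← UnitaryGroup.coe_cmDatumLocalCongr_apply L v T ha h ((UnitaryGroup.cmDatumLocalCongr L v T ha h).symm b), ContinuousMulEquiv.apply_symm_apply]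
    have hval : ((UnitaryGroup.cmDatumLocalCongr L v T ha h).symm b).val = T⁻¹ * b.val * T := by
      rw [h1]; group
    rw [hval, Units.val_mul, Units.val_mul, ← mulVec_mulVec, ← mulVec_mulVec, hTT, hp', mulVec_smul]
  have hp₀ne : (((T⁻¹ : GL (Fin 3) (UnitaryGroup.LocalRing L v)).val *ᵥ fun i => finEigenlineProjector L v H' γH b i j)) ≠ 0 := by
    intro h0
    apply hj
    rw [← hTT, h0, mulVec_zero]
  -- both signs read on eigenvectors; the `Φ₃`-length is `a⁻¹` times the `H′`-length
  rw [finKappaAt_eq_ite_of_eigenvector L v _ γH _ hv hb₀ hu hp₀ hp₀ne, finKappaAt_eq_ite_of_eigenvector L v H' γH b hv hb hu hp' hj,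
    sum_sum_map_inv_mulVec_eq_inv_mul L v H' T ha h, hxdef]
  -- index two of the norm group in the `σ`-fixed units
  set x : UnitaryGroup.LocalRing L v := twistGram (UnitaryGroup.conjLocal L (IsCMField.complexConj L) v)
    ((UnitaryGroup.adelicForm L 3 H').map (UnitaryGroup.adeleToLocal L v)) (finEigenlineProjector L v H' γH b) j j with hx
  have h432 := exists_norm_mul_iff_norm_tests_iff L v (IsCMField.complexConj L) hcδ hδ w hw haσ ha hxσ hxu (map_one _) isUnit_one
  have e1 : (∃ z : UnitaryGroup.LocalRing L v, IsUnit z ∧ (↑(ha.unit⁻¹) : UnitaryGroup.LocalRing L v) * x = z * UnitaryGroup.conjLocal L (IsCMField.complexConj L) v z) ↔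
      (∃ z : UnitaryGroup.LocalRing L v, IsUnit z ∧ x = UnitaryGroup.conjLocal L (IsCMField.complexConj L) v z * z * a) := by
    constructor
    · rintro ⟨z, hz, hz'⟩
      refine ⟨z, hz, ?_⟩
      calc x = a * ((↑(ha.unit⁻¹) : UnitaryGroup.LocalRing L v) * x) := by rw [← mul_assoc, ha.mul_val_inv, one_mul]
        _ = UnitaryGroup.conjLocal L (IsCMField.complexConj L) v z * z * a := by rw [hz']; ring
    · rintro ⟨z, hz, hz'⟩
      refine ⟨z, hz, ?_⟩
      rw [hz']
      calc (↑(ha.unit⁻¹) : UnitaryGroup.LocalRing L v) * (UnitaryGroup.conjLocal L (IsCMField.complexConj L) v z * z * a)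
          = ((↑(ha.unit⁻¹) : UnitaryGroup.LocalRing L v) * a) * (z * UnitaryGroup.conjLocal L (IsCMField.complexConj L) v z) := by ring
        _ = z * UnitaryGroup.conjLocal L (IsCMField.complexConj L) v z := by rw [ha.val_inv_mul, one_mul]
  have e2 : ∀ y : UnitaryGroup.LocalRing L v,
      (∃ z : UnitaryGroup.LocalRing L v, IsUnit z ∧ y = UnitaryGroup.conjLocal L (IsCMField.complexConj L) v z * z * 1) ↔
        (∃ z : UnitaryGroup.LocalRing L v, IsUnit z ∧ y = z * UnitaryGroup.conjLocal L (IsCMField.complexConj L) v z) := by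
    intro y
    constructor <;> rintro ⟨z, hz, hz'⟩ <;> refine ⟨z, hz, ?_⟩
    · rw [hz', mul_one, mul_comm]
    · rw [hz', mul_one, mul_comm]
  rw [e2, e2] at h432
  have key : (∃ z : UnitaryGroup.LocalRing L v, IsUnit z ∧ (↑(ha.unit⁻¹) : UnitaryGroup.LocalRing L v) * x = z * UnitaryGroup.conjLocal L (IsCMField.complexConj L) v z) ↔
      ((∃ z : UnitaryGroup.LocalRing L v, IsUnit z ∧ x = z * UnitaryGroup.conjLocal L (IsCMField.complexConj L) v z) ↔
        (∃ z : UnitaryGroup.LocalRing L v, IsUnit z ∧ a = z * UnitaryGroup.conjLocal L (IsCMField.complexConj L) v z)) := e1.trans h432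
  by_cases hxN : ∃ z : UnitaryGroup.LocalRing L v, IsUnit z ∧ x = z * UnitaryGroup.conjLocal L (IsCMField.complexConj L) v z
  · by_cases haN : ∃ z : UnitaryGroup.LocalRing L v, IsUnit z ∧ a = z * UnitaryGroup.conjLocal L (IsCMField.complexConj L) v z
    · rw [if_pos (key.2 (iff_of_true hxN haN)), if_pos haN, if_pos hxN]; norm_num
    · rw [if_neg (fun h0 => haN ((key.1 h0).1 hxN)), if_neg haN, if_pos hxN]; norm_num
  · by_cases haN : ∃ z : UnitaryGroup.LocalRing L v, IsUnit z ∧ a = z * UnitaryGroup.conjLocal L (IsCMField.complexConj L) v z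
    · rw [if_neg (fun h0 => hxN ((key.1 h0).2 haN)), if_pos haN, if_neg hxN]; norm_num
    · rw [if_pos (key.2 (iff_of_false hxN haN)), if_neg haN, if_neg hxN]; norm_num

/-! ## §3 `Δ‴_v` across the two forms -/

open scoped Classical in
/-- **`Δ‴_v^{Φ₃}(γ_H, e⁻¹γ′) = χ(a)·Δ‴_v^{H′}(γ_H, γ′)`** for `γ_H` with `χ_g(u)` a unit (every `G`-regular `γ_H`, ★ `isUnit_eval_finCharpolyTwo_of_isLocalGRegular`) and EVERY
`γ′ ∈ U(H′)_v`: off the matching pairs both sides vanish (matching is conjugacy with `ι_v(γ_H)` in the common `GL₃(E_v)` and `e` is class-preserving, ★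
`isLocalNormPair_iff_comp_of_corresponds` ∕ ★ `corresponds_cmDatumLocalCongr_symm`); on them `τ_v`, `D_v` see `γ_H` only and `κ_v` picks up `χ(a)` (§2).
[cite: Rogawski1990, §4.9 p. 55; §4.3 (4.3.2) p. 43; §14.4 p. 237] [cite: LanglandsShelstad1987, §4.2] -/
theorem finExplicitDelta_cmDatumLocalCongr_symm (w : UnitaryGroup.PlacesOver L v) (hw : IsCMField.complexConj L • w.1 = w.1)
    (hH' : (H'.map (cmConjRingHom L))ᵀ = H') (hdet : H'.det ≠ 0) (haσ : UnitaryGroup.conjLocal L (IsCMField.complexConj L) v a = a) (μ : HeckeCharacter L)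
    (γH : (UnitaryGroup.cmDatum L 2 (Matrix.of fun i j : Fin 2 => if i.val + j.val + 1 = 2 then (1 : L) else 0)).Local v ×
      (UnitaryGroup.cmDatum L 1 (Matrix.of fun i j : Fin 1 => if i.val + j.val + 1 = 1 then (1 : L) else 0)).Local v)
    (hu : IsUnit ((finCharpolyTwo L v γH).eval (finGammaTwo L v γH))) (b : (UnitaryGroup.cmDatum L 3 H').Local v) :
    finExplicitDelta L v (Matrix.of fun i j : Fin 3 => if i.val + j.val + 1 = 3 then (1 : L) else 0) γH μ ((UnitaryGroup.cmDatumLocalCongr L v T ha h).symm b) =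
      ((if ∃ z : UnitaryGroup.LocalRing L v, IsUnit z ∧ a = z * UnitaryGroup.conjLocal L (IsCMField.complexConj L) v z then (1 : ℤ) else -1 : ℤ) : ℂ) *
        finExplicitDelta L v H' γH μ b := by
  classical
  have hcl : ∀ γ' : (UnitaryGroup.cmDatum L 3 H').Local v,
      Corresponds (UnitaryGroup.conjLocal L (IsCMField.complexConj L) v) ((UnitaryGroup.adelicForm L 3 H').map (UnitaryGroup.adeleToLocal L v))
        ((UnitaryGroup.adelicForm L 3 (Matrix.of fun i j : Fin 3 => if i.val + j.val + 1 = 3 then (1 : L) else 0)).map (UnitaryGroup.adeleToLocal L v))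
        γ' ((UnitaryGroup.cmDatumLocalCongr L v T ha h).symm γ') :=
    fun γ' => corresponds_comm.1 (corresponds_cmDatumLocalCongr_symm L v T ha h γ')
  by_cases hb : IsLocalNormPair L H' v γH b
  · have hb₀ : IsLocalNormPair L (Matrix.of fun i j : Fin 3 => if i.val + j.val + 1 = 3 then (1 : L) else 0) v γH
        ((UnitaryGroup.cmDatumLocalCongr L v T ha h).symm b) :=
      (isLocalNormPair_iff_comp_of_corresponds L H' v (UnitaryGroup.cmDatumLocalCongr L v T ha h).symm hcl γH b).1 hb
    rw [finExplicitDelta_of_isLocalNormPair L v _ γH μ hb₀, finExplicitDelta_of_isLocalNormPair L v H' γH μ hb,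
      finKappaAt_cmDatumLocalCongr_symm L v H' T ha h w hw hH' hdet haσ γH hu b hb]
    push_cast
    ring
  · have hb₀ : ¬ IsLocalNormPair L (Matrix.of fun i j : Fin 3 => if i.val + j.val + 1 = 3 then (1 : L) else 0) v γH
        ((UnitaryGroup.cmDatumLocalCongr L v T ha h).symm b) :=
      fun h0 => hb ((isLocalNormPair_iff_comp_of_corresponds L H' v (UnitaryGroup.cmDatumLocalCongr L v T ha h).symm hcl γH b).2 h0)
    rw [finExplicitDelta_of_not_isLocalNormPair L v _ γH μ hb₀, finExplicitDelta_of_not_isLocalNormPair L v H' γH μ hb, mul_zero]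

/-! ## §4 The `Δ‴`-weighted orbital sums along `e` -/

section Sums

variable [∀ γ : (UnitaryGroup.cmDatum L 3 H').Local v,
    MeasurableSpace ((UnitaryGroup.cmDatum L 3 H').Local v ⧸ Subgroup.centralizer ({γ} : Set ((UnitaryGroup.cmDatum L 3 H').Local v)))]
  [∀ γ : (UnitaryGroup.cmDatum L 3 H').Local v,
    BorelSpace ((UnitaryGroup.cmDatum L 3 H').Local v ⧸ Subgroup.centralizer ({γ} : Set ((UnitaryGroup.cmDatum L 3 H').Local v)))]
  [∀ γ : (UnitaryGroup.cmDatum L 3 (Matrix.of fun i j : Fin 3 => if i.val + j.val + 1 = 3 then (1 : L) else 0)).Local v,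
    MeasurableSpace ((UnitaryGroup.cmDatum L 3 (Matrix.of fun i j : Fin 3 => if i.val + j.val + 1 = 3 then (1 : L) else 0)).Local v ⧸
      Subgroup.centralizer ({γ} : Set ((UnitaryGroup.cmDatum L 3 (Matrix.of fun i j : Fin 3 => if i.val + j.val + 1 = 3 then (1 : L) else 0)).Local v)))]
  [∀ γ : (UnitaryGroup.cmDatum L 3 (Matrix.of fun i j : Fin 3 => if i.val + j.val + 1 = 3 then (1 : L) else 0)).Local v,
    BorelSpace ((UnitaryGroup.cmDatum L 3 (Matrix.of fun i j : Fin 3 => if i.val + j.val + 1 = 3 then (1 : L) else 0)).Local v ⧸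
      Subgroup.centralizer ({γ} : Set ((UnitaryGroup.cmDatum L 3 (Matrix.of fun i j : Fin 3 => if i.val + j.val + 1 = 3 then (1 : L) else 0)).Local v)))]

open scoped Classical in
/-- **THE `Δ‴`-WEIGHTED ORBITAL SUMS TRANSPORT ALONG `e` WITH THE FACTOR `χ(a)`**: for a family `m_G` of orbital measures on `U(H′)_v`, a function `g` on `U(H′)_v`
and `γ_H` with `χ_g(u)` a unit, `Σᶠ_{c ∈ Cl U(Φ₃)_v} Δ‴_v^{Φ₃}(γ_H, out c)·Φ(c, g ∘ e; e⁻¹_* m_G) = χ(a)·Σᶠ_{c′ ∈ Cl U(H′)_v} Δ‴_v^{H′}(γ_H, out c′)·Φ(c′, g; m_G)` — reindex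
along `c ↦ e(c)` (★ `preClass`), orbital integrals transport exactly (★ `classOrbitalIntegral_transport`), `Δ‴_v^{Φ₃}(γ_H, ·)` is a class function (★
`finExplicitDelta_conj_right_all`) and §3. [cite: Rogawski1990, §14.4 p. 237; §4.3 (4.3.1) p. 43] -/
theorem finsum_finExplicitDelta_mul_classOrbitalIntegral_transport (w : UnitaryGroup.PlacesOver L v) (hw : IsCMField.complexConj L • w.1 = w.1)
    (hH' : (H'.map (cmConjRingHom L))ᵀ = H') (hdet : H'.det ≠ 0) (haσ : UnitaryGroup.conjLocal L (IsCMField.complexConj L) v a = a) (μ : HeckeCharacter L)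
    (mG : OrbitalMeasureFamily ((UnitaryGroup.cmDatum L 3 H').Local v)) (g : (UnitaryGroup.cmDatum L 3 H').Local v → ℂ)
    (γH : (UnitaryGroup.cmDatum L 2 (Matrix.of fun i j : Fin 2 => if i.val + j.val + 1 = 2 then (1 : L) else 0)).Local v ×
      (UnitaryGroup.cmDatum L 1 (Matrix.of fun i j : Fin 1 => if i.val + j.val + 1 = 1 then (1 : L) else 0)).Local v)
    (hu : IsUnit ((finCharpolyTwo L v γH).eval (finGammaTwo L v γH))) :
    (∑ᶠ c : ConjClasses ((UnitaryGroup.cmDatum L 3 (Matrix.of fun i j : Fin 3 => if i.val + j.val + 1 = 3 then (1 : L) else 0)).Local v),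
        finExplicitDelta L v (Matrix.of fun i j : Fin 3 => if i.val + j.val + 1 = 3 then (1 : L) else 0) γH μ (Quotient.out c) *
          classOrbitalIntegral
            (mG.transport (UnitaryGroup.cmDatumLocalCongr L v T ha h).symm.toMulEquiv (UnitaryGroup.cmDatumLocalCongr L v T ha h).symm.continuous
              (UnitaryGroup.cmDatumLocalCongr L v T ha h).continuous)
            (g ∘ UnitaryGroup.cmDatumLocalCongr L v T ha h) c) =
      ((if ∃ z : UnitaryGroup.LocalRing L v, IsUnit z ∧ a = z * UnitaryGroup.conjLocal L (IsCMField.complexConj L) v z then (1 : ℤ) else -1 : ℤ) : ℂ) *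
        ∑ᶠ c : ConjClasses ((UnitaryGroup.cmDatum L 3 H').Local v), finExplicitDelta L v H' γH μ (Quotient.out c) * classOrbitalIntegral mG g c := by
  classical
  set ψ : (UnitaryGroup.cmDatum L 3 H').Local v ≃* (UnitaryGroup.cmDatum L 3 (Matrix.of fun i j : Fin 3 => if i.val + j.val + 1 = 3 then (1 : L) else 0)).Local v :=
    (UnitaryGroup.cmDatumLocalCongr L v T ha h).symm.toMulEquiv with hψ
  -- `c ↦ e(c)` is a bijection on conjugacy classes
  have hbij : Function.Bijective (fun c : ConjClasses ((UnitaryGroup.cmDatum L 3 (Matrix.of fun i j : Fin 3 => if i.val + j.val + 1 = 3 then (1 : L) else 0)).Local v) =>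
      preClass ψ c) := by
    refine ⟨fun c₁ c₂ h12 => ?_, fun c' => ⟨c'.map ψ.toMonoidHom, preClass_map ψ c'⟩⟩
    have h' : preClass ψ c₁ = preClass ψ c₂ := h12
    rw [← map_preClass ψ c₁, ← map_preClass ψ c₂, h']
  rw [mul_finsum]
  refine finsum_eq_of_bijective (fun c => preClass ψ c) hbij fun c => ?_
  -- orbital integrals transport exactly; `(g ∘ e) ∘ e⁻¹ = g`
  have hf : (g ∘ (UnitaryGroup.cmDatumLocalCongr L v T ha h)) ∘ ψ = g := by
    funext b
    show g ((UnitaryGroup.cmDatumLocalCongr L v T ha h) ((UnitaryGroup.cmDatumLocalCongr L v T ha h).symm b)) = g b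
    rw [ContinuousMulEquiv.apply_symm_apply]
  rw [classOrbitalIntegral_transport, hf]
  -- `Δ‴(γ_H, out c) = Δ‴(γ_H, e⁻¹ (out (e c)))` (conjugate) `= χ(a)·Δ‴^{H′}(γ_H, out (e c))`
  obtain ⟨y, hy⟩ := isConj_iff.1 (isConj_apply_out_preClass ψ c)
  rw [← hy, finExplicitDelta_conj_right_all L (Matrix.of fun i j : Fin 3 => if i.val + j.val + 1 = 3 then (1 : L) else 0) μ v γH _ y,
    show ψ (Quotient.out (preClass ψ c)) = (UnitaryGroup.cmDatumLocalCongr L v T ha h).symm (Quotient.out (preClass ψ c)) from rfl,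
    finExplicitDelta_cmDatumLocalCongr_symm L v H' T ha h w hw hH' hdet haσ μ γH hu]
  ring

/-! ## §5 The `Δ‴`-transfer identity at the identity descends along `e` -/

variable [∀ γH : (UnitaryGroup.cmDatum L 2 (Matrix.of fun i j : Fin 2 => if i.val + j.val + 1 = 2 then (1 : L) else 0)).Local v ×
      (UnitaryGroup.cmDatum L 1 (Matrix.of fun i j : Fin 1 => if i.val + j.val + 1 = 1 then (1 : L) else 0)).Local v,
    MeasurableSpace (((UnitaryGroup.cmDatum L 2 (Matrix.of fun i j : Fin 2 => if i.val + j.val + 1 = 2 then (1 : L) else 0)).Local v ×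
      (UnitaryGroup.cmDatum L 1 (Matrix.of fun i j : Fin 1 => if i.val + j.val + 1 = 1 then (1 : L) else 0)).Local v) ⧸
      Subgroup.centralizer ({γH} : Set ((UnitaryGroup.cmDatum L 2 (Matrix.of fun i j : Fin 2 => if i.val + j.val + 1 = 2 then (1 : L) else 0)).Local v ×
        (UnitaryGroup.cmDatum L 1 (Matrix.of fun i j : Fin 1 => if i.val + j.val + 1 = 1 then (1 : L) else 0)).Local v)))]

open scoped Classical in
/-- **THE `Δ‴`-TRANSFER IDENTITY AT THE IDENTITY DESCENDS ALONG `e`** (the conclusion text of the S3-tree partial head `localTransferAtOne_of_hyperspecialLevel_le_two` and of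
`stub_N6nsS3id`, at one place): if for the transported pair `(e⁻¹_* m_G, g ∘ e)` on `U(Φ₃)(L⁺_v)` there are `V ∈ 𝓝 1` in `H_v` and `φ^H ∈ C_c^∞(H_v)` with
`Φ^st(γ_H, φ^H) = Σᶠ_c Δ‴_v^{Φ₃}(γ_H, out c)·Φ(c, g ∘ e)` for every `G`-regular `γ_H ∈ V`, then the same holds VERBATIM for `(m_G, g)` on `U(H′)(L⁺_v)` with Rogawski's explicit
collection for `H′` — take `χ(a)·φ^H` (★ `stableOrbitalIntegralRel_smul_fun`, §4, `χ(a)² = 1`; `χ_g(u)` is a unit at `G`-regular `γ_H`, ★ `isUnit_eval_finCharpolyTwo_of_isLocalGRegular`).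
So a head proved for `Φ₃` (good reduction at every `w`) holds for every `H′` at `v`, its pieces read on the hyperspecial `e(K₃)`: the good-reduction pair `hH′w hH′i` drops.
[cite: Rogawski1990, §14.4 p. 237; §4.9 Prop. 4.9.1 p. 55; §4.3 (4.3.1)–(4.3.2) p. 43] [cite: LanglandsShelstad1987, §4.2] -/
theorem localTransferAtOne_transport_of_formCongr (w : UnitaryGroup.PlacesOver L v) (hw : IsCMField.complexConj L • w.1 = w.1)
    (hH' : (H'.map (cmConjRingHom L))ᵀ = H') (hdet : H'.det ≠ 0) (haσ : UnitaryGroup.conjLocal L (IsCMField.complexConj L) v a = a) (μ : HeckeCharacter L)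
    (mH : OrbitalMeasureFamily ((UnitaryGroup.cmDatum L 2 (Matrix.of fun i j : Fin 2 => if i.val + j.val + 1 = 2 then (1 : L) else 0)).Local v ×
      (UnitaryGroup.cmDatum L 1 (Matrix.of fun i j : Fin 1 => if i.val + j.val + 1 = 1 then (1 : L) else 0)).Local v))
    (mG : OrbitalMeasureFamily ((UnitaryGroup.cmDatum L 3 H').Local v)) (g : (UnitaryGroup.cmDatum L 3 H').Local v → ℂ)
    (hΦ : ∃ V ∈ 𝓝 (1 : (UnitaryGroup.cmDatum L 2 (Matrix.of fun i j : Fin 2 => if i.val + j.val + 1 = 2 then (1 : L) else 0)).Local v ×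
        (UnitaryGroup.cmDatum L 1 (Matrix.of fun i j : Fin 1 => if i.val + j.val + 1 = 1 then (1 : L) else 0)).Local v),
      ∃ φH : (UnitaryGroup.cmDatum L 2 (Matrix.of fun i j : Fin 2 => if i.val + j.val + 1 = 2 then (1 : L) else 0)).Local v ×
          (UnitaryGroup.cmDatum L 1 (Matrix.of fun i j : Fin 1 => if i.val + j.val + 1 = 1 then (1 : L) else 0)).Local v → ℂ,
        IsLocSmooth φH ∧ ∀ γH ∈ V, IsLocalGRegular L v γH →
          stableOrbitalIntegralRel (IsLocalStablyConjH L v) mH φH γH =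
            ∑ᶠ c : ConjClasses ((UnitaryGroup.cmDatum L 3 (Matrix.of fun i j : Fin 3 => if i.val + j.val + 1 = 3 then (1 : L) else 0)).Local v),
              ((finExplicitCollection L (Matrix.of fun i j : Fin 3 => if i.val + j.val + 1 = 3 then (1 : L) else 0) μ
                  (finExplicitDelta_conj_left_all L (Matrix.of fun i j : Fin 3 => if i.val + j.val + 1 = 3 then (1 : L) else 0) μ)
                  (finExplicitDelta_conj_right_all L (Matrix.of fun i j : Fin 3 => if i.val + j.val + 1 = 3 then (1 : L) else 0) μ)) v).Δ γH (Quotient.out c) *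
                classOrbitalIntegral
                  (mG.transport (UnitaryGroup.cmDatumLocalCongr L v T ha h).symm.toMulEquiv (UnitaryGroup.cmDatumLocalCongr L v T ha h).symm.continuous
                    (UnitaryGroup.cmDatumLocalCongr L v T ha h).continuous)
                  (g ∘ UnitaryGroup.cmDatumLocalCongr L v T ha h) c) :
    ∃ V ∈ 𝓝 (1 : (UnitaryGroup.cmDatum L 2 (Matrix.of fun i j : Fin 2 => if i.val + j.val + 1 = 2 then (1 : L) else 0)).Local v ×
        (UnitaryGroup.cmDatum L 1 (Matrix.of fun i j : Fin 1 => if i.val + j.val + 1 = 1 then (1 : L) else 0)).Local v),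
      ∃ φH : (UnitaryGroup.cmDatum L 2 (Matrix.of fun i j : Fin 2 => if i.val + j.val + 1 = 2 then (1 : L) else 0)).Local v ×
          (UnitaryGroup.cmDatum L 1 (Matrix.of fun i j : Fin 1 => if i.val + j.val + 1 = 1 then (1 : L) else 0)).Local v → ℂ,
        IsLocSmooth φH ∧ ∀ γH ∈ V, IsLocalGRegular L v γH →
          stableOrbitalIntegralRel (IsLocalStablyConjH L v) mH φH γH =
            ∑ᶠ c : ConjClasses ((UnitaryGroup.cmDatum L 3 H').Local v),
              ((finExplicitCollection L H' μ (finExplicitDelta_conj_left_all L H' μ) (finExplicitDelta_conj_right_all L H' μ)) v).Δ γH (Quotient.out c) *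
                classOrbitalIntegral mG g c := by
  classical
  obtain ⟨V, hV, φH, hφ, hid⟩ := hΦ
  set χ : ℂ := ((if ∃ z : UnitaryGroup.LocalRing L v, IsUnit z ∧ a = z * UnitaryGroup.conjLocal L (IsCMField.complexConj L) v z then (1 : ℤ) else -1 : ℤ) : ℂ) with hχ
  have hχχ : χ * χ = 1 := by
    rw [hχ]
    split_ifs <;> norm_num
  refine ⟨V, hV, χ • φH, ⟨hφ.1.comp fun z => χ * z, hφ.2.mono (Function.support_const_smul_subset χ φH)⟩, fun γH hγV hreg => ?_⟩
  rw [stableOrbitalIntegralRel_smul_fun, hid γH hγV hreg]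
  simp only [finExplicitCollection_Δ]
  rw [finsum_finExplicitDelta_mul_classOrbitalIntegral_transport L v H' T ha h w hw hH' hdet haσ μ mG g γH
    (isUnit_eval_finCharpolyTwo_of_isLocalGRegular L v γH hreg), ← mul_assoc, ← hχ, hχχ, one_mul]

end Sums

end Literature.NumberTheory.Rogawski1990

end
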